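import Literature.NumberTheory.Transcendental.BorelDworkEstimate
import Mathlib.Analysis.SpecificLimits.Normed
import Mathlib.Tactic
import HarnessLib

/-!
# Borel's rationality theorem (the disc case of the Borel–Pólya theorem)

É. Borel (1894): *an integer power series `f = Σ aₙ xⁿ ∈ ℤ⟦x⟧` which is the Taylor expansion
of a function meromorphic on a disc `|x| < R` of radius `R > 1` is the expansion of a rational
function.* This is the disc case `Ω = D(0,R)` (conformal radius `R`) of the Borel–Pólya
theorem quoted by Calegari–Dimitrov–Tang as the starting point of arithmetic holonomy bounds
(arXiv:2408.15403, §1.2 **Theorem 3** (Borel–Pólya, [PolyaOriginal]): "A power series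
`P(x) ∈ ℤ⟦x⟧` that continues analytically to a simply connected open region `0 ∈ Ω ⊂ ℂ` of
conformal radius `ρ(Ω,0) = |φ'(0)| > 1` is necessarily a rational function", in the case where
`Ω` is the disc, for meromorphic continuation — "the conformal radius of the disc `D_R` is `R`").

Meromorphy is taken in the concrete, pole-cleared form in which it is always used: there is a
complex polynomial `P` with `P(0) ≠ 0` and a function `h` holomorphic on `|z| < R` whose Taylor
germ at `0` is the Cauchy product `P · f`. (The poles of `f` in the disc are the zeros of `P`;
`P(0) ≠ 0` since `f` is holomorphic at `0`; positivity of the radius of convergence of `f` is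
assumed explicitly.)

Proof: `BorelDworkEstimate.lean` bounds the Hankel determinants
`Δₘ = det(a_{i+j})_{i,j≤m} ∈ ℤ` by a quantity decaying like `R'^{−m²/2}`, so `Δₘ = 0` for
large `m`, and Kronecker's criterion (`KroneckerRationalityCriterion.lean`) yields polynomials
`Q ≠ 0`, `P'` over `ℚ` with `Q·f = P'`.

## Contents (all proved; no named facts)

* `Borel.tendsto_majorant` — the majorant `(m+1)!·R'^{-(0+⋯+m)}·(K₁ K₂^m)^e·K₃^{m+1} → 0`.
* `Borel.hankelDet_intCast`, `Borel.hankelDet_ratCast` — `Δₘ` commutes with the casts.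
* `Borel.exists_polynomial_mul_eq_of_meromorphic` — **Borel's theorem** as above.

## References

* É. Borel, *Sur une application d'un théorème de M. Hadamard*, Bull. Sci. Math. (2) 18
  (1894), 22–25.
* G. Pólya, *Über gewisse notwendige Determinantenkriterien für die Fortsetzbarkeit einer
  Potenzreihe*, Math. Ann. 99 (1928), 687–706.
* [CalegariDimitrovTang2024] arXiv:2408.15403, §1.2 Theorem 3 (Borel–Pólya), §2.1, §2.7.1.
-/

noncomputable section

open Filter Metric Finset Matrix
open scoped Topology Nat

namespace Literature.NumberTheory.Transcendental

namespace Borel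

/-! ### The majorant tends to zero -/

/-- The super-exponential decay of the Borel–Dwork majorant: for `R' > 1`, `K₁, K₂, K₃ ≥ 1`,
`(m+1)! · (R'⁻¹)^{0+1+⋯+m} · (K₁ · K₂^m)^e · K₃^{m+1} → 0` — indeed it is
`≤ K₁^e · uₘ^{m+1}` with `uₘ = (m+1) · (√R')^{−m} · K₂^e · K₃ → 0`. [folklore] -/
theorem tendsto_majorant {R' K₁ K₂ K₃ : ℝ} (hR' : 1 < R') (hK₁ : 1 ≤ K₁) (hK₂ : 1 ≤ K₂)
    (hK₃ : 1 ≤ K₃) (e : ℕ) :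
    Tendsto (fun m : ℕ => ((m + 1)! : ℝ) * (R'⁻¹) ^ (∑ i ∈ range (m + 1), i)
      * (K₁ * K₂ ^ m) ^ e * K₃ ^ (m + 1)) atTop (𝓝 0) := by
  have hR'0 : 0 < R' := by linarith
  set s : ℝ := (Real.sqrt R')⁻¹ with hs
  have hsqrt1 : 1 < Real.sqrt R' := by
    rw [show (1 : ℝ) = Real.sqrt 1 from Real.sqrt_one.symm]
    exact Real.sqrt_lt_sqrt zero_le_one hR'
  have hs0 : 0 < s := by rw [hs]; positivity
  have hs1 : s < 1 := by rw [hs]; exact inv_lt_one_of_one_lt₀ hsqrt1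
  have hs2 : s ^ 2 = R'⁻¹ := by
    rw [hs, inv_pow, Real.sq_sqrt hR'0.le]
  -- `u m → 0`
  set L : ℝ := K₂ ^ e * K₃ with hL
  have hL1 : 1 ≤ L := by rw [hL]; nlinarith [one_le_pow₀ (n := e) hK₂]
  set u : ℕ → ℝ := fun m => ((m : ℝ) + 1) * s ^ m * L with hu
  have hu_tendsto : Tendsto u atTop (𝓝 0) := by
    have h1 : Tendsto (fun m : ℕ => (m : ℝ) * s ^ m) atTop (𝓝 0) :=
      tendsto_self_mul_const_pow_of_lt_one hs0.le hs1
    have h2 : Tendsto (fun m : ℕ => s ^ m) atTop (𝓝 0) :=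
      tendsto_pow_atTop_nhds_zero_of_lt_one hs0.le hs1
    have h3 : Tendsto (fun m : ℕ => ((m : ℝ) * s ^ m + s ^ m) * L) atTop (𝓝 ((0 + 0) * L)) :=
      (h1.add h2).mul_const L
    rw [zero_add, zero_mul] at h3
    refine h3.congr' (Eventually.of_forall fun m => ?_)
    simp only [hu]; ring
  have hu0 : ∀ m, 0 ≤ u m := fun m => by simp only [hu]; positivity
  -- the majorant is `≤ K₁^e · u m ^ (m+1)`
  have hmaj : ∀ m : ℕ, ((m + 1)! : ℝ) * (R'⁻¹) ^ (∑ i ∈ range (m + 1), i)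
      * (K₁ * K₂ ^ m) ^ e * K₃ ^ (m + 1) ≤ K₁ ^ e * u m ^ (m + 1) := by
    intro m
    -- factorial
    have hfact : ((m + 1)! : ℝ) ≤ ((m : ℝ) + 1) ^ (m + 1) := by
      have := Nat.factorial_le_pow (m + 1)
      exact_mod_cast this
    -- the triangular number
    have hT : (R'⁻¹) ^ (∑ i ∈ range (m + 1), i) = (s ^ m) ^ (m + 1) := by
      rw [← hs2, ← pow_mul, ← pow_mul]
      congr 1
      have := Finset.sum_range_id_mul_two (m + 1)
      simp only [Nat.add_sub_cancel] at this
      linarith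
    -- the geometric factor
    have hgeo : (K₁ * K₂ ^ m) ^ e ≤ K₁ ^ e * (K₂ ^ e) ^ (m + 1) := by
      rw [mul_pow, ← pow_mul, ← pow_mul]
      exact mul_le_mul_of_nonneg_left (pow_le_pow_right₀ hK₂ (by nlinarith))
        (by positivity)
    calc ((m + 1)! : ℝ) * (R'⁻¹) ^ (∑ i ∈ range (m + 1), i) * (K₁ * K₂ ^ m) ^ e * K₃ ^ (m + 1)
        ≤ ((m : ℝ) + 1) ^ (m + 1) * (s ^ m) ^ (m + 1) * (K₁ ^ e * (K₂ ^ e) ^ (m + 1))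
          * K₃ ^ (m + 1) := by
          rw [hT]; gcongr
      _ = K₁ ^ e * u m ^ (m + 1) := by
          simp only [hu, hL, mul_pow, ← pow_mul]
          ring
  -- conclude by squeezing
  have hlim : Tendsto (fun m : ℕ => K₁ ^ e * u m ^ (m + 1)) atTop (𝓝 0) := by
    -- eventually `u m ≤ 1/2`, so `u m ^ (m+1) ≤ (1/2)^(m+1) → 0`
    have hhalf : Tendsto (fun m : ℕ => K₁ ^ e * (1 / 2 : ℝ) ^ (m + 1)) atTop (𝓝 0) := by
      have h := (tendsto_pow_atTop_nhds_zero_of_lt_one (r := (1 / 2 : ℝ)) (by norm_num)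
        (by norm_num)).comp (tendsto_add_atTop_nat 1)
      have h' := h.const_mul (K₁ ^ e)
      rw [mul_zero] at h'
      exact h'
    have hev : ∀ᶠ m : ℕ in atTop, u m ≤ 1 / 2 :=
      hu_tendsto.eventually (ge_mem_nhds (by norm_num))
    refine squeeze_zero' (Eventually.of_forall fun m => by positivity) ?_ hhalf
    filter_upwards [hev] with m hm
    have := hu0 m
    gcongr
  exact squeeze_zero' (Eventually.of_forall fun m => by positivity)
    (Eventually.of_forall hmaj) hlim

/-! ### Hankel determinants and casts -/

/-- `Δₘ` of the complexified sequence is the cast of the integer `Δₘ`. [folklore] -/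
theorem hankelDet_intCast (a : ℕ → ℤ) (m : ℕ) :
    Kronecker.hankelDet (fun n => (a n : ℂ)) m = ((Kronecker.hankelDet a m : ℤ) : ℂ) := by
  rw [Kronecker.hankelDet, Kronecker.hankelDet, ← eq_intCast (Int.castRingHom ℂ),
    RingHom.map_det]
  congr 1

/-- `Δₘ` over `ℚ` is the cast of the integer `Δₘ`. [folklore] -/
theorem hankelDet_ratCast (a : ℕ → ℤ) (m : ℕ) :
    Kronecker.hankelDet (fun n => (a n : ℚ)) m = ((Kronecker.hankelDet a m : ℤ) : ℚ) := by
  rw [Kronecker.hankelDet, Kronecker.hankelDet, ← eq_intCast (Int.castRingHom ℚ),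
    RingHom.map_det]
  congr 1

/-! ### Borel's theorem -/

/-- **Borel's rationality theorem** (Borel 1894; the disc case of Calegari–Dimitrov–Tang's
Theorem 3 "Borel–Pólya"): let `f = Σ aₙ xⁿ ∈ ℤ⟦x⟧` have a positive radius of convergence and
be *meromorphic on the disc `|x| < R` with `R > 1`* in the pole-cleared sense — there are a
polynomial `P ∈ ℂ[x]` with `P(0) ≠ 0` and a function `h` holomorphic on `|z| < R` whose Taylor
germ at `0` is `P·f`, i.e. `h(z) = Σₙ (Σ_{i≤n} Pᵢ a_{n−i}) zⁿ` near `0`. Then `f` is the expansion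
of a rational function: `Q · f = P'` in `ℚ⟦x⟧` for some polynomials `Q ≠ 0`, `P'` over `ℚ`.
[cite: CalegariDimitrovTang2024, §1.2 Theorem 3 (Borel–Pólya), disc case (p. 5)] -/
theorem exists_polynomial_mul_eq_of_meromorphic {a : ℕ → ℤ} {R : ℝ} (hR : 1 < R)
    (ha : ∃ ρ : ℝ, 0 < ρ ∧ Summable fun n => (a n : ℝ) * ρ ^ n)
    (P : Polynomial ℂ) (hP0 : P.coeff 0 ≠ 0) {h : ℂ → ℂ}
    (hh : DifferentiableOn ℂ h (ball (0 : ℂ) R))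
    (hgerm : ∀ᶠ z in 𝓝 (0 : ℂ),
      HasSum (fun n => (∑ i ∈ range (n + 1), P.coeff i * (a (n - i) : ℂ)) * z ^ n) (h z)) :
    ∃ Q : Polynomial ℚ, Q ≠ 0 ∧ ∃ P' : Polynomial ℚ,
      (Q : PowerSeries ℚ) * PowerSeries.mk (fun n => (a n : ℚ)) = P' := by
  -- radii and the degree
  set e : ℕ := P.natDegree with he
  set p₀ : ℂ := P.coeff 0 with hp₀
  set R' : ℝ := (1 + R) / 2 with hR'
  have hR'1 : 1 < R' := by rw [hR']; linarith
  have hR'R : R' < R := by rw [hR']; linarith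
  have hR'0 : 0 < R' := by linarith
  -- the coefficients `b = P * a` and their Cauchy bound
  set b : ℕ → ℂ := fun n => ∑ i ∈ range (n + 1), P.coeff i * (a (n - i) : ℂ) with hb
  obtain ⟨C, hC0, hC⟩ := exists_norm_mul_pow_le_of_differentiableOn hR'0 hR'R hh hgerm
  -- normalised data
  set a' : ℕ → ℂ := fun n => (a n : ℂ) with ha'
  set p : ℕ → ℂ := fun t => P.coeff t / p₀ with hp
  set b' : ℕ → ℂ := fun n => b n / p₀ with hb'
  have hp0' : p 0 = 1 := by simp only [hp, hp₀]; exact div_self hP0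
  have hbb' : ∀ n, e ≤ n → b' n = ∑ t ∈ range (e + 1), p t * a' (n - t) := by
    intro n hn
    simp only [hb', hb, hp, ha']
    rw [Finset.sum_div]
    symm
    rw [← Finset.sum_subset (Finset.range_subset_range.mpr (by omega : e + 1 ≤ n + 1))]
    · refine Finset.sum_congr rfl fun t _ => ?_
      ring
    · intro i _ hi
      have hi' : e < i := by
        simp only [Finset.mem_range, not_lt] at hi
        omega
      rw [Polynomial.coeff_eq_zero_of_natDegree_lt hi', zero_mul, zero_div]
  -- bounds on `a'`
  obtain ⟨ρ, hρ0, hρsum⟩ := ha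
  obtain ⟨Ca, hCa⟩ : ∃ Ca, ∀ n, ‖(a n : ℝ) * ρ ^ n‖ ≤ Ca := by
    obtain ⟨Ca, hCa⟩ := hρsum.tendsto_atTop_zero.norm.bddAbove_range
    exact ⟨Ca, fun n => hCa ⟨n, rfl⟩⟩
  set ρ₁ : ℝ := min ρ 1 with hρ₁
  have hρ₁0 : 0 < ρ₁ := lt_min hρ0 zero_lt_one
  have hρ₁1 : ρ₁ ≤ 1 := min_le_right _ _
  have hρ₁ρ : ρ₁ ≤ ρ := min_le_left _ _
  have ha_bd : ∀ n, ‖a' n‖ * ρ₁ ^ n ≤ Ca := by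
    intro n
    have h1 := hCa n
    rw [norm_mul, norm_pow, Real.norm_of_nonneg hρ0.le] at h1
    have h2 : ‖a' n‖ = ‖(a n : ℝ)‖ := by
      simp only [ha', Complex.norm_intCast, Real.norm_eq_abs]
    rw [h2]
    calc ‖(a n : ℝ)‖ * ρ₁ ^ n ≤ ‖(a n : ℝ)‖ * ρ ^ n := by
          gcongr
      _ ≤ Ca := h1
  have hb_bd : ∀ n, ‖b' n‖ * R' ^ n ≤ C / ‖p₀‖ := by
    intro n
    have hp₀n : 0 < ‖p₀‖ := norm_pos_iff.mpr hP0
    rw [le_div_iff₀ hp₀n]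
    simp only [hb']
    rw [norm_div]
    calc ‖b n‖ / ‖p₀‖ * R' ^ n * ‖p₀‖ = ‖b n‖ * R' ^ n := by field_simp
      _ ≤ C := hC n
  -- the determinant estimate, for `m ≥ e`
  set Cb : ℝ := C / ‖p₀‖ with hCb
  have hest : ∀ m, e ≤ m → ‖Kronecker.hankelDet a' m‖ ≤ ((m + 1)! : ℝ)
      * (R'⁻¹) ^ (∑ i ∈ range (m + 1), i)
      * (max Ca 1 * (ρ₁⁻¹) ^ (2 * m) * R' ^ m) ^ e * (max Cb 1) ^ (m + 1) :=
    fun m hm => norm_hankelDet_le hp0' hbb' hρ₁0 hρ₁1 hR'1.le ha_bd hb_bd hm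
  -- the majorant tends to `0`
  have hlim := tendsto_majorant (K₁ := max Ca 1) (K₂ := (ρ₁⁻¹) ^ 2 * R') (K₃ := max Cb 1)
    hR'1 (le_max_right _ _) (by
      have : (1 : ℝ) ≤ ρ₁⁻¹ := one_le_inv_iff₀.mpr ⟨hρ₁0, hρ₁1⟩
      nlinarith [one_le_pow₀ (n := 2) this]) (le_max_right _ _) e
  have hev : ∀ᶠ m : ℕ in atTop, Kronecker.hankelDet a m = 0 := by
    have h1 : ∀ᶠ m : ℕ in atTop, ((m + 1)! : ℝ) * (R'⁻¹) ^ (∑ i ∈ range (m + 1), i)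
        * (max Ca 1 * ((ρ₁⁻¹) ^ 2 * R') ^ m) ^ e * (max Cb 1) ^ (m + 1) < 1 :=
      hlim.eventually (gt_mem_nhds zero_lt_one)
    filter_upwards [h1, eventually_ge_atTop e] with m hm hme
    have h2 := hest m hme
    have h3 : (max Ca 1 * (ρ₁⁻¹) ^ (2 * m) * R' ^ m) = max Ca 1 * ((ρ₁⁻¹) ^ 2 * R') ^ m := by
      rw [mul_pow, ← pow_mul]; ring
    rw [h3] at h2
    have h4 : ‖Kronecker.hankelDet a' m‖ < 1 := lt_of_le_of_lt h2 hm
    rw [show Kronecker.hankelDet a' m = ((Kronecker.hankelDet a m : ℤ) : ℂ) from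
      hankelDet_intCast a m, Complex.norm_intCast] at h4
    have h5 : |Kronecker.hankelDet a m| < 1 := by exact_mod_cast h4
    exact Int.abs_lt_one_iff.mp h5
  -- Kronecker's criterion over `ℚ`
  obtain ⟨m₁, hm₁⟩ := eventually_atTop.mp hev
  refine Kronecker.exists_polynomial_mul_eq_of_hankelDet_eq_zero (fun n => (a n : ℚ))
    (m₁ := m₁) fun m hm => ?_
  rw [hankelDet_ratCast, hm₁ m hm, Int.cast_zero]

end Borel

end Literature.NumberTheory.Transcendental
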